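import Summits.Ventures.Crystal3D.Theorems.StickyWulffConstantCoaxialWallLawOnSiteBridgeCxTwoSqrtSix
import Summits.Ventures.Crystal3D.Theorems.StickyWulffConstantCoaxialWallLawEndRowJointDefs
import HarnessLib

/-!
# The on-site DOMINATION and 𝒰_cx BRIDGE for the JOINT basal end row (T-F2's census object)
# (crux `CoaxialWallLaw`, stmt-Ventures-19481, line `WallLedgerF`; serves lane T's debt T-F2 via `EndRowJointA`)

HONEST FRAMING. Venture `Summits/Ventures/Crystal3D` (cell `crystal3d-full`), helper `--supports` the crux
`CoaxialWallLaw` (stmt-Ventures-19481, `route-Ventures-StickyWulffConstant`), REGISTERED line `WallLedgerF` (planner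
cf-p1).  Rung credit; F-C1 not moved; census-free.  cf-p1 DECISION (lxxxiii)(3) (2026-08-29T01:52:19Z): «BRIDGE brick
(signature family + dominate lemma à la p681542 for the pooled family) = 19481-p2».  The JOINT row (`…EndRowJointDefs`,
19481-p1): `EndRowJointA v s_F = ∀ L, LocalEndRowA v s_F ⟨L, basalHexagon⟩ ⟨H·L, basalHexagon⟩`.  This file is the
`jointSigs` analogue of `…OnSiteDominateMenuTwin` + `…OnSiteBridgeCx`:

* `dominate_joint_of_roots_menu` — both plates active (root classes only, basal-axis base frame): every (A)-end pair near
  the payer is a signature pair of `jointSigs` (= `{false, true} × basalHexagon`);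
* `dominate_joint_menu` — in general: SOME `transSigs ε n` dominates (one plate active: the wall's basal plane sits on an
  inclined model plane `n`), OR `jointSigs` dominates (both active);
* `exists_jointSig_bound_menu` — packaging at a window congruent to a pattern `P ⊆ W` (menu set `W`);
* **`localSummandA_joint_le_of_onSite_menu`**, **`endRowJointA_of_onSite_menu`** — the bridge for any universe inside a menu
  set: `EndRowOnSiteA v s_F 𝒰` (translation rows, for the inclined case) + `EndRowOnSiteJointA v s_F 𝒰` + the joint tail ⇒
  `EndRowJointA v s_F`;
* 𝒰_cx instance: `endRowOnSiteJointA_cx_of_flat`, **`endRowJointA_of_onSiteFlatA_cx`**, and the instance of record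
  **`endRowJointA_v2_twoSqrtSix_cx : EndRowOnSiteFlatA v2 (9/2) 𝒰_cx → EndRowOnSiteJointFlatA v2 (2√6) 𝒰_cx →
  EndRowJointTailA v2 (2√6) 𝒰_cx → EndRowJointA v2 (2√6)`** (the translation certificate of record at `9/2` serves the
  inclined case by monotonicity).
REMAINING BY-NAME DEBTS for `EndRowJointA v2 (2√6)`: the certificate `EndRowOnSiteJointFlatA v2 (2√6) coaxialModuleUniverse`
(cf-p2 'jointrow'), the off-module joint tail `EndRowJointTailA v2 (2√6) coaxialModuleUniverse`, and lane F's
`EndRowOnSiteFlatA v2 (9/2) coaxialModuleUniverse` (bnb-ucx).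
WHAT THIS IS NOT: no certificate, no tail theorem; F-C1 not moved.
-/

noncomputable section

namespace Summit.Ventures.Crystal3D.Theorems

open Summit.Ventures.Crystal3D Finset
open Literature.MathematicalPhysics.StatisticalMechanics (basalMirror basalMirror_apply_coord basalMirror_basalMirror)
open scoped InnerProductSpace

/-- Joint signatures are slot signatures. -/
theorem jointSigs_slots : ∀ σ ∈ jointSigs, σ.2 ∈ fccSlots := by
  classical
  intro σ hσ
  unfold jointSigs at hσ
  rcases mem_union.1 hσ with h | h
  · obtain ⟨w, hw, rfl⟩ := mem_image.1 h
    exact (mem_filter.1 hw).1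
  · obtain ⟨w, hw, rfl⟩ := mem_image.1 h
    exact (mem_filter.1 hw).1

/-- Joint signatures have unit directions. -/
theorem norm_eq_one_of_mem_jointSigs {σ : Bool × EuclideanSpace ℝ (Fin 3)} (hσ : σ ∈ jointSigs) : ‖σ.2‖ = 1 :=
  norm_eq_one_of_mem_fccSlots (jointSigs_slots σ hσ)

section Dominate

variable {v : WordVersion} {Y : Finset (EuclideanSpace ℝ (Fin 3))} {W : Set (EuclideanSpace ℝ (Fin 3))}

/-- **DOMINATION FOR ROOT-ONLY JOINT SYSTEMS** (basal-axis base frame `L′`, its half-turn companion, basal roots `R`, all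
standard classes root classes): every (A)-end pair near the payer is a signature pair of `jointSigs`. -/
theorem dominate_joint_of_roots_menu (hW : ∀ q ∈ W, ∀ x ∈ W, dist q x = 1 →
      x - q ∈ fccSlots ∨ x - q ∈ (basalMirror : EuclideanSpace ℝ (Fin 3) → EuclideanSpace ℝ (Fin 3)) '' ↑fccSlots)
    (hY : ∀ x ∈ Y, dist (0 : EuclideanSpace ℝ (Fin 3)) x ≤ 3 → x ∈ W)
    (L' : EuclideanSpace ℝ (Fin 3) ≃ₗᵢ[ℝ] EuclideanSpace ℝ (Fin 3))
    (R : Finset (EuclideanSpace ℝ (Fin 3))) (hR : R ⊆ basalHexagon) (ε : Bool)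
    (hL : (L' : EuclideanSpace ℝ (Fin 3) → EuclideanSpace ℝ (Fin 3)) '' ↑fccSlots =
      (sigFrame ε : EuclideanSpace ℝ (Fin 3) → EuclideanSpace ℝ (Fin 3)) '' ↑fccSlots)
    (hax : L' (EuclideanSpace.single (2 : Fin 3) (1 : ℝ)) = EuclideanSpace.single (2 : Fin 3) (1 : ℝ) ∨
      L' (EuclideanSpace.single (2 : Fin 3) (1 : ℝ)) = -EuclideanSpace.single (2 : Fin 3) (1 : ℝ))
    (hroot₁ : ∀ r ∈ R, ∀ κ : List (EuclideanSpace ℝ (Fin 3)), WFChain r κ →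
      (((⟨L', R⟩ : PlateSystem).Fw κ : EuclideanSpace ℝ (Fin 3) → EuclideanSpace ℝ (Fin 3)) '' ↑fccSlots = ↑fccSlots ∨
        ((⟨L', R⟩ : PlateSystem).Fw κ : EuclideanSpace ℝ (Fin 3) → EuclideanSpace ℝ (Fin 3)) '' ↑fccSlots =
          (basalMirror : EuclideanSpace ℝ (Fin 3) → EuclideanSpace ℝ (Fin 3)) '' ↑fccSlots) → κ = [])
    (hroot₂ : ∀ r ∈ R, ∀ κ : List (EuclideanSpace ℝ (Fin 3)), WFChain r κ →
      (((⟨((ℝ ∙ EuclideanSpace.single (2 : Fin 3) (1 : ℝ)).reflection).trans L', R⟩ : PlateSystem).Fw κ :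
          EuclideanSpace ℝ (Fin 3) → EuclideanSpace ℝ (Fin 3)) '' ↑fccSlots = ↑fccSlots ∨
        ((⟨((ℝ ∙ EuclideanSpace.single (2 : Fin 3) (1 : ℝ)).reflection).trans L', R⟩ : PlateSystem).Fw κ :
          EuclideanSpace ℝ (Fin 3) → EuclideanSpace ℝ (Fin 3)) '' ↑fccSlots =
          (basalMirror : EuclideanSpace ℝ (Fin 3) → EuclideanSpace ℝ (Fin 3)) '' ↑fccSlots) → κ = []) :
    ∀ b q : EuclideanSpace ℝ (Fin 3), dist (0 : EuclideanSpace ℝ (Fin 3)) b ≤ 1 →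
      IsEndPairA Y v ⟨L', R⟩ ⟨((ℝ ∙ EuclideanSpace.single (2 : Fin 3) (1 : ℝ)).reflection).trans L', R⟩ b q →
      IsEndPairSig Y v jointSigs b q := by
  classical
  set e₃ : EuclideanSpace ℝ (Fin 3) := EuclideanSpace.single (2 : Fin 3) (1 : ℝ) with he₃
  have hRs : R ⊆ fccSlots := fun r hr => (mem_filter.1 (hR hr)).1
  -- root images are basal slots
  have hroot_img : ∀ r ∈ R, L' r ∈ fccSlots ∧ (L' r) 2 = 0 := by
    intro r hr
    obtain ⟨hrS, hr2⟩ := mem_filter.1 (hR hr)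
    have key : ⟪L' r, L' e₃⟫_ℝ = 0 := by rw [LinearIsometryEquiv.inner_map_map, he₃, inner_single_two_one, hr2]
    have h2 : (L' r) 2 = 0 := by
      rw [← inner_single_two_one, ← he₃]
      rcases hax with hax | hax
      · rwa [hax] at key
      · rw [hax, inner_neg_right] at key; linarith
    have hmem : L' r ∈ (L' : EuclideanSpace ℝ (Fin 3) → EuclideanSpace ℝ (Fin 3)) '' ↑fccSlots := ⟨r, mem_coe.2 hrS, rfl⟩
    rw [hL] at hmem
    obtain ⟨w₀, hw₀, heq⟩ := hmem
    have hw₀2 : w₀ 2 = 0 := by rw [← sigFrame_apply_two_eq_zero_iff ε, heq, h2]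
    have hLr : L' r = w₀ := by rw [← heq, sigFrame_of_basal ε hw₀2]
    have hslot : L' r ∈ fccSlots := by rw [hLr]; exact mem_coe.1 hw₀
    exact ⟨hslot, h2⟩
  -- the companion's slot dozen
  have hsymm : L'.symm e₃ = e₃ ∨ L'.symm e₃ = -e₃ := by
    rcases hax with hax | hax
    · left
      have := congrArg L'.symm hax
      rw [LinearIsometryEquiv.symm_apply_apply] at this
      exact this.symm
    · right
      have := congrArg L'.symm hax
      rw [LinearIsometryEquiv.symm_apply_apply, map_neg] at this
      rw [← neg_eq_iff_eq_neg]; exact this.symm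
  have hcomm : ∀ x, basalMirror (L' x) = L' (basalMirror x) := by
    intro x
    rw [basalMirror_map, basalMirror_apply_eq]
    rcases hsymm with hsy | hsy
    · rw [hsy]
    · rw [hsy, inner_neg_right, smul_neg, mul_neg, neg_smul, neg_neg]
  have himg₂ : ((((ℝ ∙ e₃).reflection).trans L' : EuclideanSpace ℝ (Fin 3) ≃ₗᵢ[ℝ] EuclideanSpace ℝ (Fin 3)) :
        EuclideanSpace ℝ (Fin 3) → EuclideanSpace ℝ (Fin 3)) '' ↑fccSlots =
      (sigFrame (!ε) : EuclideanSpace ℝ (Fin 3) → EuclideanSpace ℝ (Fin 3)) '' ↑fccSlots := by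
    rw [← image_fccSlots_basalMirror_eq_halfTurn, image_sigFrame_not, ← hL, Set.image_image]
    refine Set.image_congr fun x _ => ?_
    rw [LinearIsometryEquiv.trans_apply]
    change L' (basalMirror x) = _
    exact (hcomm x).symm
  intro b q hb hpair
  obtain ⟨hq, hbY, hpay, G, d, hadm, hqd, hmove⟩ := hpair
  have hstd := std_of_isEndPairA_menu hW hY (S₁ := ⟨L', R⟩) (S₂ := ⟨((ℝ ∙ e₃).reflection).trans L', R⟩) hRs hRs hb
    ⟨hq, hbY, hpay, G, d, hadm, hqd, hmove⟩ hmove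
  rcases hadm with ⟨r, hr, κ, hκ, hG, hd⟩ | ⟨r, hr, κ, hκ, hG, hd⟩
  · -- bottom root class: signature `(ε, L' r)`
    have hκ0 : κ = [] := hroot₁ r hr κ hκ (by rw [← hG]; exact hstd)
    subst hκ0
    obtain ⟨hslot, h2⟩ := hroot_img r hr
    have hGL : G = L' := hG
    have hdd : d = L' r := by rw [hd]; simp [PlateSystem.Fw]
    have hsd : sigDir (ε, L' r) = d := by rw [sigDir, hdd]; exact sigFrame_of_basal ε h2
    have himg : (G : EuclideanSpace ℝ (Fin 3) → EuclideanSpace ℝ (Fin 3)) '' ↑fccSlots =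
        (sigFrame ε : EuclideanSpace ℝ (Fin 3) → EuclideanSpace ℝ (Fin 3)) '' ↑fccSlots := by rw [hGL, hL]
    refine ⟨hq, hbY, hpay, (ε, L' r), mem_jointSigs_of_basal (mem_filter.2 ⟨hslot, h2⟩), by rw [hsd]; exact hqd, ?_⟩
    rw [hsd]
    exact (isEndMove_congr himg v d q b).1 hmove
  · -- top root class: signature `(¬ε, −L' r)`
    have hκ0 : κ = [] := hroot₂ r hr κ hκ (by rw [← hG]; exact hstd)
    subst hκ0
    obtain ⟨hslot, h2⟩ := hroot_img r hr
    obtain ⟨-, hr2⟩ := mem_filter.1 (hR hr)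
    have hdd : d = -L' r := by
      rw [hd]; simp only [PlateSystem.Fw, List.length_nil, pow_zero, one_smul, LinearIsometryEquiv.trans_apply]
      rw [halfTurn_of_basal hr2, map_neg]
    have h2' : (-L' r) 2 = 0 := by
      have : (-L' r) 2 = -((L' r) 2) := rfl
      rw [this, h2, neg_zero]
    have hsd : sigDir (!ε, -L' r) = d := by rw [sigDir, hdd]; exact sigFrame_of_basal (!ε) h2'
    have himg : (G : EuclideanSpace ℝ (Fin 3) → EuclideanSpace ℝ (Fin 3)) '' ↑fccSlots =
        (sigFrame (!ε) : EuclideanSpace ℝ (Fin 3) → EuclideanSpace ℝ (Fin 3)) '' ↑fccSlots := by rw [hG]; exact himg₂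
    refine ⟨hq, hbY, hpay, (!ε, -L' r), mem_jointSigs_of_basal (mem_filter.2 ⟨neg_mem_fccSlots hslot, h2'⟩),
      by rw [hsd]; exact hqd, ?_⟩
    rw [hsd]
    exact (isEndMove_congr himg v d q b).1 hmove

/-- **DOMINATION, JOINT SYSTEMS** (any base frame `L′`, basal roots): some `transSigs ε n` dominates (one plate
active) or `jointSigs` dominates (both plates active). -/
theorem dominate_joint_menu (hW : ∀ q ∈ W, ∀ x ∈ W, dist q x = 1 →
      x - q ∈ fccSlots ∨ x - q ∈ (basalMirror : EuclideanSpace ℝ (Fin 3) → EuclideanSpace ℝ (Fin 3)) '' ↑fccSlots)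
    (hY : ∀ x ∈ Y, dist (0 : EuclideanSpace ℝ (Fin 3)) x ≤ 3 → x ∈ W)
    (L' : EuclideanSpace ℝ (Fin 3) ≃ₗᵢ[ℝ] EuclideanSpace ℝ (Fin 3)) (R : Finset (EuclideanSpace ℝ (Fin 3)))
    (hR : R ⊆ basalHexagon) :
    (∃ ε : Bool, ∃ n ∈ modelNormals, ∀ b q : EuclideanSpace ℝ (Fin 3), dist (0 : EuclideanSpace ℝ (Fin 3)) b ≤ 1 →
      IsEndPairA Y v ⟨L', R⟩ ⟨((ℝ ∙ EuclideanSpace.single (2 : Fin 3) (1 : ℝ)).reflection).trans L', R⟩ b q →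
      IsEndPairSig Y v (transSigs ε n) b q) ∨
    (∀ b q : EuclideanSpace ℝ (Fin 3), dist (0 : EuclideanSpace ℝ (Fin 3)) b ≤ 1 →
      IsEndPairA Y v ⟨L', R⟩ ⟨((ℝ ∙ EuclideanSpace.single (2 : Fin 3) (1 : ℝ)).reflection).trans L', R⟩ b q →
      IsEndPairSig Y v jointSigs b q) := by
  classical
  set S₁ : PlateSystem := ⟨L', R⟩ with hS₁
  set S₂ : PlateSystem := ⟨((ℝ ∙ EuclideanSpace.single (2 : Fin 3) (1 : ℝ)).reflection).trans L', R⟩ with hS₂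
  have hR2 : ∀ r ∈ R, r 2 = 0 := fun r hr => (mem_filter.1 (hR hr)).2
  by_cases h₁ : ∃ r ∈ R, ∃ κ : List (EuclideanSpace ℝ (Fin 3)), WFChain r κ ∧
      ((S₁.Fw κ : EuclideanSpace ℝ (Fin 3) → EuclideanSpace ℝ (Fin 3)) '' ↑fccSlots = ↑fccSlots ∨
        (S₁.Fw κ : EuclideanSpace ℝ (Fin 3) → EuclideanSpace ℝ (Fin 3)) '' ↑fccSlots =
          (basalMirror : EuclideanSpace ℝ (Fin 3) → EuclideanSpace ℝ (Fin 3)) '' ↑fccSlots)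
  · by_cases h₂ : ∃ r ∈ R, ∃ κ : List (EuclideanSpace ℝ (Fin 3)), WFChain r κ ∧
        ((S₂.Fw κ : EuclideanSpace ℝ (Fin 3) → EuclideanSpace ℝ (Fin 3)) '' ↑fccSlots = ↑fccSlots ∨
          (S₂.Fw κ : EuclideanSpace ℝ (Fin 3) → EuclideanSpace ℝ (Fin 3)) '' ↑fccSlots =
            (basalMirror : EuclideanSpace ℝ (Fin 3) → EuclideanSpace ℝ (Fin 3)) '' ↑fccSlots)
    · -- both plates active: root classes only, basal-axis base frame, `jointSigs` dominates
      right
      obtain ⟨r₁, hr₁, κ₁, hκ₁, hstd₁⟩ := h₁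
      obtain ⟨r₂, hr₂, κ₂, hκ₂, hstd₂⟩ := h₂
      obtain ⟨-, -, hLstd, hax⟩ := twin_collapse L' R R (hR2 r₁ hr₁) hκ₁ hstd₁ (hR2 r₂ hr₂) hκ₂ hstd₂
      obtain ⟨ε, hL⟩ := exists_sigFrame_of_std hLstd
      exact dominate_joint_of_roots_menu hW hY L' R hR ε hL hax
        (fun r hr κ hκ hstd => (twin_collapse L' R R (hR2 r hr) hκ hstd (hR2 r₂ hr₂) hκ₂ hstd₂).1)
        (fun r hr κ hκ hstd => (twin_collapse L' R R (hR2 r₁ hr₁) hκ₁ hstd₁ (hR2 r hr) hκ hstd).2.1)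
    · -- only the bottom plate is active
      left
      obtain ⟨F, σ, hσ, hFstd, hcol⟩ := class_collapse S₁
      obtain ⟨ε, hF⟩ := exists_sigFrame_of_std hFstd
      obtain ⟨n, hn, hdom⟩ := dominate_of_collapse_menu hW hY S₁ S₂ hR hR ε F σ hσ hF (by
        rintro S (rfl | rfl) r hr κ hκ hstd
        · exact hcol r hr κ hκ hstd
        · exact absurd ⟨r, hr, κ, hκ, hstd⟩ h₂)
      exact ⟨ε, n, hn, hdom⟩
  · -- the bottom plate is not active: collapse the top one
    left
    obtain ⟨F, σ, hσ, hFstd, hcol⟩ := class_collapse S₂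
    obtain ⟨ε, hF⟩ := exists_sigFrame_of_std hFstd
    obtain ⟨n, hn, hdom⟩ := dominate_of_collapse_menu hW hY S₁ S₂ hR hR ε F σ hσ hF (by
      rintro S (rfl | rfl) r hr κ hκ hstd
      · exact absurd ⟨r, hr, κ, hκ, hstd⟩ h₁
      · exact hcol r hr κ hκ hstd)
    exact ⟨ε, n, hn, hdom⟩

end Dominate

/-! ### Packaging and the bridge -/

open scoped Classical in
/-- **Joint-row bound at a menu window**: some translation signature row or `jointSigs` bounds the joint summand,
for every frame `L`. -/
theorem exists_jointSig_bound_menu {v : WordVersion} {W : Set (EuclideanSpace ℝ (Fin 3))}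
    (hW : ∀ q ∈ W, ∀ x ∈ W, dist q x = 1 →
      x - q ∈ fccSlots ∨ x - q ∈ (basalMirror : EuclideanSpace ℝ (Fin 3) → EuclideanSpace ℝ (Fin 3)) '' ↑fccSlots)
    {X P : Finset (EuclideanSpace ℝ (Fin 3))} {z : EuclideanSpace ℝ (Fin 3)}
    (S : EuclideanSpace ℝ (Fin 3) ≃ₗᵢ[ℝ] EuclideanSpace ℝ (Fin 3))
    (hagree : ∀ y, dist (0 : EuclideanSpace ℝ (Fin 3)) y ≤ 3 → (y ∈ X.image (fun x => S.symm x + -S.symm z) ↔ y ∈ P))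
    (hPW : ∀ p ∈ P, p ∈ W) (L : EuclideanSpace ℝ (Fin 3) ≃ₗᵢ[ℝ] EuclideanSpace ℝ (Fin 3)) :
    (∃ ε : Bool, ∃ n ∈ modelNormals,
      localSummandA v (basalSystem L)
        (basalSystem (((ℝ ∙ EuclideanSpace.single (2 : Fin 3) (1 : ℝ)).reflection).trans L)) X z ≤
        localStatSig P v (transSigs ε n) 0) ∨
    localSummandA v (basalSystem L)
        (basalSystem (((ℝ ∙ EuclideanSpace.single (2 : Fin 3) (1 : ℝ)).reflection).trans L)) X z ≤
      localStatSig P v jointSigs 0 := by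
  have hYW : ∀ x ∈ X.image (fun x => S.symm x + -S.symm z), dist (0 : EuclideanSpace ℝ (Fin 3)) x ≤ 3 → x ∈ W :=
    fun x hx hd => hPW x ((hagree x hd).1 hx)
  have hassoc : (((ℝ ∙ EuclideanSpace.single (2 : Fin 3) (1 : ℝ)).reflection).trans L).trans S.symm =
      ((ℝ ∙ EuclideanSpace.single (2 : Fin 3) (1 : ℝ)).reflection).trans (L.trans S.symm) :=
    LinearIsometryEquiv.ext fun _ => rfl
  unfold basalSystem
  rcases dominate_joint_menu (v := v) hW hYW (L.trans S.symm) basalHexagon subset_rfl with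
    ⟨ε, n, hn, hdom⟩ | hdom
  · rw [← hassoc] at hdom
    exact Or.inl ⟨ε, n, hn, localSummandA_le_localStatSig_window S hagree L _ _ _ (transSigs_slots ε n) hdom⟩
  · rw [← hassoc] at hdom
    exact Or.inr (localSummandA_le_localStatSig_window S hagree L _ _ _ jointSigs_slots hdom)

section MenuBridge

variable {v : WordVersion} {sF : ℝ} {𝒰 : Set (Finset (EuclideanSpace ℝ (Fin 3)))} {W : Set (EuclideanSpace ℝ (Fin 3))}

open scoped Classical in
/-- **Bridge, joint row**: at a payer window on-site for a universe of patterns inside a menu set `W`, the joint summand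
is `≤ s_F` for every frame, given the translation on-site fact AND the joint on-site fact on `𝒰`. -/
theorem localSummandA_joint_le_of_onSite_menu
    (hW : ∀ q ∈ W, ∀ x ∈ W, dist q x = 1 →
      x - q ∈ fccSlots ∨ x - q ∈ (basalMirror : EuclideanSpace ℝ (Fin 3) → EuclideanSpace ℝ (Fin 3)) '' ↑fccSlots)
    (h𝒰 : ∀ P ∈ 𝒰, ∀ p ∈ P, p ∈ W) (honT : EndRowOnSiteA v sF 𝒰) (honJ : EndRowOnSiteJointA v sF 𝒰)
    (L : EuclideanSpace ℝ (Fin 3) ≃ₗᵢ[ℝ] EuclideanSpace ℝ (Fin 3))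
    {X : Finset (EuclideanSpace ℝ (Fin 3))} {z : EuclideanSpace ℝ (Fin 3)} (hsite : OnSiteAt 𝒰 X z) :
    localSummandA v (basalSystem L)
        (basalSystem (((ℝ ∙ EuclideanSpace.single (2 : Fin 3) (1 : ℝ)).reflection).trans L)) X z ≤ sF := by
  obtain ⟨P, hP, S, hwin⟩ := hsite
  rcases exists_jointSig_bound_menu (v := v) hW S (onSite_window_agree hwin) (h𝒰 P hP) L with
    ⟨ε, n, hn, hle⟩ | hle
  · exact hle.trans ((honT P hP).1 ε n hn)
  · exact hle.trans (honJ P hP)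

open scoped Classical in
/-- **The reduction, joint row**: on-site case (for 𝒰) plus the joint tail give `EndRowJointA`. -/
theorem endRowJointA_of_onSite_of_tail (𝒰 : Set (Finset (EuclideanSpace ℝ (Fin 3))))
    (hon : ∀ L : EuclideanSpace ℝ (Fin 3) ≃ₗᵢ[ℝ] EuclideanSpace ℝ (Fin 3),
      ∀ X : Finset (EuclideanSpace ℝ (Fin 3)), (∀ p ∈ X, ∀ q ∈ X, p ≠ q → 1 ≤ dist p q) →
      ∀ z ∈ X, (X.filter fun q => dist z q = 1).card ≤ 11 → OnSiteAt 𝒰 X z →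
        localSummandA v (basalSystem L)
          (basalSystem (((ℝ ∙ EuclideanSpace.single (2 : Fin 3) (1 : ℝ)).reflection).trans L)) X z ≤ sF)
    (htail : EndRowJointTailA v sF 𝒰) : EndRowJointA v sF := by
  intro L X hX z hz hz11
  by_cases h : OnSiteAt 𝒰 X z
  · exact hon L X hX z hz hz11 h
  · exact htail L X hX z hz hz11 h

/-- **`EndRowJointA` from the two on-site facts on `𝒰 ⊆ 𝒫(W)` and the joint tail over `𝒰`.** -/
theorem endRowJointA_of_onSite_menu
    (hW : ∀ q ∈ W, ∀ x ∈ W, dist q x = 1 →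
      x - q ∈ fccSlots ∨ x - q ∈ (basalMirror : EuclideanSpace ℝ (Fin 3) → EuclideanSpace ℝ (Fin 3)) '' ↑fccSlots)
    (h𝒰 : ∀ P ∈ 𝒰, ∀ p ∈ P, p ∈ W) (honT : EndRowOnSiteA v sF 𝒰) (honJ : EndRowOnSiteJointA v sF 𝒰)
    (htail : EndRowJointTailA v sF 𝒰) : EndRowJointA v sF :=
  endRowJointA_of_onSite_of_tail 𝒰 (fun L _ _ _ _ _ hsite => localSummandA_joint_le_of_onSite_menu hW h𝒰 honT honJ L hsite)
    htail

end MenuBridge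

/-! ### The coaxial-module instance -/

open scoped Classical in
/-- On 𝒰_cx the flat joint certificate implies the plain joint on-site fact. -/
theorem endRowOnSiteJointA_cx_of_flat {v : WordVersion} {sF : ℝ} (h : EndRowOnSiteJointFlatA v sF coaxialModuleUniverse) :
    EndRowOnSiteJointA v sF coaxialModuleUniverse :=
  fun P hP => (localStatSig_le_localStatSigFlat_self (fun _ hσ => norm_eq_one_of_mem_jointSigs hσ) hP.2.2.1 hP.2.2.2).trans
    (h P hP)

/-- **`EndRowJointA` from the 𝒰_cx translation certificate, the 𝒰_cx joint certificate and the OFF-MODULE joint tail**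
(same version, same constant). -/
theorem endRowJointA_of_onSiteFlatA_cx {v : WordVersion} {sF : ℝ} (honT : EndRowOnSiteFlatA v sF coaxialModuleUniverse)
    (honJ : EndRowOnSiteJointFlatA v sF coaxialModuleUniverse) (htail : EndRowJointTailA v sF coaxialModuleUniverse) :
    EndRowJointA v sF :=
  endRowJointA_of_onSite_menu coaxialModule_menu (fun _ hP => mem_coaxialModule_of_mem_universe hP)
    (endRowOnSiteA_cx_of_flat honT) (endRowOnSiteJointA_cx_of_flat honJ) htail

/-- **INSTANCE OF RECORD (cf-p1 (lxxxiii)): `EndRowJointA v2 (2√6)`** from lane F's translation certificate of record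
`EndRowOnSiteFlatA v2 (9/2) 𝒰_cx` (bnb-ucx; fed through monotonicity `9/2 ≤ 2√6`), the joint certificate
`EndRowOnSiteJointFlatA v2 (2√6) 𝒰_cx` ('jointrow'), and the off-module joint tail at `2√6`. -/
theorem endRowJointA_v2_twoSqrtSix_cx (honT : EndRowOnSiteFlatA WordVersion.v2 (9 / 2) coaxialModuleUniverse)
    (honJ : EndRowOnSiteJointFlatA WordVersion.v2 (2 * Real.sqrt 6) coaxialModuleUniverse)
    (htail : EndRowJointTailA WordVersion.v2 (2 * Real.sqrt 6) coaxialModuleUniverse) :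
    EndRowJointA WordVersion.v2 (2 * Real.sqrt 6) :=
  endRowJointA_of_onSiteFlatA_cx (endRowOnSiteFlatA_mono_const nine_halves_le_two_sqrt_six honT) honJ htail

end Summit.Ventures.Crystal3D.Theorems

end
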